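import Literature.Probability.RandomPlanarGeometry.HexSAWRotSurfaceArmchairDictionary
import Literature.Probability.RandomPlanarGeometry.HexSAWArmchairUnfolding
import HarnessLib

/-!
# Beaton 2014, Proposition 7, first sentence, for EVERY `y > 0`: `μ(y) = lim_n C⁺_n(y)^{1/n}` EXISTS in the rotated frame,
# and equals `max(β_rot(y), μ)`; `μ(y) = μ ↔ y ≤ y†`

Topic `Literature/Probability/RandomPlanarGeometry` (the capstone of the lane's door «HEX-YC-ROT-LIMIT-ALL-Y»; continues
`HexSAWRotSurfaceArmchairDictionary.lean` — the dictionary `rotHpCoeff (n+1) y = Cw n y`, `rotSurfaceMu`, and the limit GIVEN the face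
«ARM-ARCH-BOUND» — and `HexSAWArmchairUnfolding.lean` — `archBound_holds`, the face discharged by Beaton's fixed-length unfolding along the
armchair surface; R5 `HexSAWRotSurfaceYcLimit.lean` gave the limit for `0 < y ≤ y†` only).

Sources. N. R. Beaton, *The critical surface fugacity of self-avoiding walks on a rotated honeycomb lattice*, J. Phys. A 47 (2014) 075003,
arXiv:1210.0274v3: §3.1, Proposition 7 (p. 11: "For `y > 0`, `μ(y) := lim_{n→∞} C_n^+(y)^{1/n}` exists and is finite. … `μ(y) = μ` if
`y ≤ y_c`, `> μ` if `y > y_c`") and its proof (pp. 12–14: unfolded walks `U^+_n(y)`, "`μ(y) = lim U_n^+(y)^{1/n}` exists", the fixed-length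
unfolding, "`limsup C^+_n(y)^{1/n} ≤ μ(y)`", "`U^+_n(y) ≤ C^+_n(y)`, and hence `μ(y) ≤ liminf C^+_n(y)^{1/n}`"); Theorem 1 (p. 2: `y_c = y†`).
J. M. Hammersley, G. M. Torrie, S. G. Whittington, *Self-avoiding walks interacting with a surface*, J. Phys. A 15 (1982) 539, §2
(existence of the surface free energy for the hypercubic lattice — the argument Beaton adapts).  H. Duminil-Copin, S. Smirnov, Ann. of Math. 175
(2012) 1653, Theorem 1 (`μ = √(2+√2)`).

## What is proved (lane «pcv-sawmu», seat a-p6 g10; no hypotheses beyond `0 < y`)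

* **`tendsto_rotHpCoeff_rpow (hy : 0 < y) : Tendsto (fun n => rotHpCoeff n y ^ (n : ℝ)⁻¹) atTop (𝓝 (rotSurfaceMu y))`** — Beaton's
  Proposition 7, first sentence, for every `y > 0`, with the VALUE of the limit identified: `rotSurfaceMu y = max (armRate y) μ`, `armRate y`
  = the Fekete growth rate of the armchair wall bridges (= Beaton's unfolded walks along the rotated surface);
* `exists_tendsto_rotHpCoeff_rpow` (the printed existence clause verbatim), `eventually_rotHpCoeff_le_pow` (`limsup ≤`, rate form),
  `le_rotSurfaceMu_of_rotGrowthGeRate` (every eventual lower rate is `≤ μ(y)`);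
* **`rotSurfaceMu_eq_iff (hy : 0 < y) : rotSurfaceMu y = μ ↔ y ≤ y†`**, `hexConnectiveConstant_lt_rotSurfaceMu_iff` (`μ < μ(y) ↔ y† < y`),
  `rotSurfaceMu_eq_armRate` (`μ(y) = β_rot(y)` above `y†`), **`hexConnectiveConstant_lt_armRate_iff : μ < β_rot(y) ↔ y† < y`**;
* `rotSurfaceMu_mono` (non-decreasing in `y`).

LABEL: CONSOLIDATION of Beaton 2014 Proposition 7, sentence 1 (printed with proof sketch "the proof of [HTW82] can be applied mutatis
mutandis"): first machine-checked proof, in the rotated (armchair) frame where the unfolding mirror has no vertex on it; NEW-IN-WRITING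
(size S): the identification `μ(y) = max(β_rot(y), μ)` and `μ < β_rot(y) ↔ y > y†`.  Not decided here: log-convexity / continuity /
a.e. differentiability of `μ(y)` in the rotated frame (the remaining printed clauses; the DCS-frame twins are a-idea-1 g21's S1 riders).
-/

noncomputable section

open Finset Filter Function
open Literature.Probability.LatticeModels Literature.Probability.Percolation SimpleGraph
open _root_.Topology

namespace Literature.Probability.RandomPlanarGeometry.SAW.HV

open HexBW.Arm

variable {y : ℝ}

/-- **Beaton 2014, Proposition 7, first sentence, for EVERY `y > 0`**: `C⁺_n(y)^{1/n} → μ_rot(y) = max(β_rot(y), μ)` — the limit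
`μ(y) = lim_n C⁺_n(y)^{1/n}` of the rotated-honeycomb half-plane partition functions EXISTS (and is identified).
[cite: Beaton2014RotatedHoneycomb, Proposition 7 (arXiv v3 p. 11: "For y > 0, μ(y) := lim_{n→∞} C_n^+(y)^{1/n} exists and is finite")] -/
theorem tendsto_rotHpCoeff_rpow (hy : 0 < y) :
    Tendsto (fun n : ℕ => rotHpCoeff n y ^ ((n : ℝ)⁻¹)) atTop (𝓝 (rotSurfaceMu y)) :=
  tendsto_rotHpCoeff_rpow_of_archBound hy (archBound_holds hy)

/-- The printed existence clause: **`lim_n C⁺_n(y)^{1/n}` exists and is a finite positive number**, for every `y > 0`.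
[cite: Beaton2014RotatedHoneycomb, Proposition 7 (arXiv v3 p. 11: "exists and is finite")] -/
theorem exists_tendsto_rotHpCoeff_rpow (hy : 0 < y) :
    ∃ μy : ℝ, 0 < μy ∧ Tendsto (fun n : ℕ => rotHpCoeff n y ^ ((n : ℝ)⁻¹)) atTop (𝓝 μy) :=
  ⟨rotSurfaceMu y, rotSurfaceMu_pos y, tendsto_rotHpCoeff_rpow hy⟩

/-- **`limsup_n C⁺_n(y)^{1/n} ≤ μ_rot(y)`**, rate form: for every `r > μ_rot(y)`, eventually `C⁺_n(y) ≤ rⁿ`.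
[cite: Beaton2014RotatedHoneycomb, §3.1, proof of Proposition 7 (arXiv v3 p. 14: "limsup C^+_n(y)^{1/n} ≤ μ(y)")] -/
theorem eventually_rotHpCoeff_le_pow (hy : 0 < y) {r : ℝ} (hr : rotSurfaceMu y < r) :
    ∀ᶠ n : ℕ in atTop, rotHpCoeff n y ≤ r ^ n :=
  eventually_rotHpCoeff_le_pow_of_archBound hy (archBound_holds hy) hr

/-- Every eventual lower rate of `C⁺_n(y)` is at most the limit `μ_rot(y)`. [cite: Beaton2014RotatedHoneycomb, Proposition 7 (arXiv v3 p. 11: "μ(y) ≥ max{μ, √y}")] -/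
theorem le_rotSurfaceMu_of_rotGrowthGeRate (hy : 0 < y) {ρ : ℝ} (h : RotGrowthGeRate y ρ) : ρ ≤ rotSurfaceMu y := by
  by_contra hlt
  rw [not_le] at hlt
  set s := (rotSurfaceMu y + ρ) / 2 with hs
  have h1 : rotSurfaceMu y < s := by rw [hs]; linarith
  have h2 : s < ρ := by rw [hs]; linarith
  have hs0 : 0 ≤ s := (rotSurfaceMu_pos y).le.trans h1.le
  set s' := (rotSurfaceMu y + s) / 2 with hs'
  have h3 : rotSurfaceMu y < s' := by rw [hs']; linarith
  have h4 : s' < s := by rw [hs']; linarith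
  have hs'0 : 0 < s' := (rotSurfaceMu_pos y).trans h3
  obtain ⟨n, hn1, hn2, hn0⟩ := ((h s hs0 h2).and ((eventually_rotHpCoeff_le_pow hy h3).and (eventually_gt_atTop 0))).exists
  have : s ^ n ≤ s' ^ n := hn1.trans hn2
  have hlt' : s' ^ n < s ^ n := pow_lt_pow_left₀ h4 hs'0.le hn0.ne'
  linarith

/-- **`μ_rot(y) = μ ↔ y ≤ y†`**: the limit equals the bulk connective constant exactly on Beaton's desorbed regime.
[cite: Beaton2014RotatedHoneycomb, Theorem 1 (arXiv v3 p. 2) and Proposition 7 (p. 11: "μ(y) = μ if y ≤ y_c, > μ if y > y_c")] -/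
theorem rotSurfaceMu_eq_iff (hy : 0 < y) : rotSurfaceMu y = hexConnectiveConstant ↔ y ≤ rotYdagger :=
  rotSurfaceMu_eq_iff_of_archBound hy (archBound_holds hy)

/-- **`μ < μ_rot(y) ↔ y† < y`** (the adsorbed regime). [cite: Beaton2014RotatedHoneycomb, Proposition 7 (arXiv v3 p. 11: "μ(y) > μ if y > y_c")] -/
theorem hexConnectiveConstant_lt_rotSurfaceMu_iff (hy : 0 < y) : hexConnectiveConstant < rotSurfaceMu y ↔ rotYdagger < y :=
  hexConnectiveConstant_lt_rotSurfaceMu_iff_of_archBound hy (archBound_holds hy)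

/-- **`μ < β_rot(y) ↔ y† < y`**: above `y†` the armchair wall bridges alone grow strictly faster than bulk self-avoiding walks.
[cite: Beaton2014RotatedHoneycomb, Proposition 7 (arXiv v3 p. 11); HammersleyTorrieWhittington1982, §2] -/
theorem hexConnectiveConstant_lt_armRate_iff (hy : 0 < y) : hexConnectiveConstant < armRate y ↔ rotYdagger < y :=
  hexConnectiveConstant_lt_armRate_iff_of_archBound hy (archBound_holds hy)

/-- Above `y†`, `μ_rot(y) = β_rot(y)`. [cite: Beaton2014RotatedHoneycomb, Proposition 7 (arXiv v3 p. 11)] -/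
theorem rotSurfaceMu_eq_armRate (hy : 0 < y) (h : rotYdagger < y) : rotSurfaceMu y = armRate y :=
  max_eq_left ((hexConnectiveConstant_lt_armRate_iff hy).2 h).le

/-- `μ_rot` is non-decreasing on `(0, ∞)` (as a limit of non-decreasing functions). [cite: Beaton2014RotatedHoneycomb, Proposition 7 (arXiv v3 p. 11: "non-decreasing")] -/
theorem rotSurfaceMu_mono (hy : 0 < y) {y' : ℝ} (hyy' : y ≤ y') : rotSurfaceMu y ≤ rotSurfaceMu y' := by
  have hy' : 0 < y' := hy.trans_le hyy'
  refine le_rotSurfaceMu_of_rotGrowthGeRate hy' fun r hr0 hr => ?_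
  filter_upwards [rotGrowthGeRate_rotSurfaceMu hy r hr0 hr] with n hn
  exact hn.trans (rotHpCoeff_mono n hy.le hyy')

end Literature.Probability.RandomPlanarGeometry.SAW.HV
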